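import Summits.KontsevichZagierPeriods.KontsevichZagierPeriods.Theorems.RootDecompZetaThreeFrontierRungFourPreludeP03

/-! # `RootDecompZetaThreeFrontierRungFourPreludeP04` — part 4/14 of the mechanical ≤400-line split of `pre_src.lean` (sha256 ba362a5194d75c20…)
Source: decomp-kz lens-1 g12/g13 rung-4 prelude = Prelude_v3.lean @ba362a51 (Basis22_v1 sections RotFour/Shuffle/ProdFour/GenFb/WordMoves/RungFour/Basis22 + FacetGeneric_v2 §1–§23; critic CLEARED g6 row 330 / g6-20 l.1368); --supports stmt-KontsevichZagierPeriods-27141.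
Split by census-1 g10 `gen/splitlean.py`: scopes re-opened with their `open`/`variable`/`set_option` context; mathematics and declaration order unchanged. -/

set_option linter.dupNamespace false
noncomputable section
namespace Summit.KontsevichZagierPeriods.KontsevichZagierPeriods.Cruxes.GZNormalFormWThree.GZLadder.ProdFour
open Set MeasureTheory MvPolynomial
open Literature.NumberTheory.Transcendental
open Literature.ModelTheory.ExponentialFields

open Set MeasureTheory MvPolynomial in
open Literature.NumberTheory.Transcendental in
open Literature.ModelTheory.ExponentialFields in
/-- Auxiliary step `mem_Δ4`: mem Δ4. [bookkeeping] -/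
private theorem mem_Δ4 (t : Fin 4 → ℝ) :
    t ∈ KZ.openOrderedSimplex 4 ↔ 0 < t 3 ∧ t 3 < t 2 ∧ t 2 < t 1 ∧ t 1 < t 0 ∧ t 0 < 1 := by
  constructor
  · rintro ⟨h0, h1, ha⟩
    exact ⟨h0 3, ha (show (2 : Fin 4) < 3 by decide), ha (show (1 : Fin 4) < 2 by decide),
      ha (show (0 : Fin 4) < 1 by decide), h1 0⟩
  · rintro ⟨h3, h32, h21, h10, h0⟩
    have hsa : StrictAnti t := by
      refine Fin.strictAnti_iff_succ_lt.mpr fun i => ?_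
      fin_cases i
      · simpa using h10
      · simpa using h21
      · simpa using h32
    exact ⟨fun i => lt_of_lt_of_le h3 (hsa.antitone (Fin.le_last i)),
      fun i => lt_of_le_of_lt (hsa.antitone (Fin.le_iff_val_le_val.2 (Nat.zero_le _))) h0, hsa⟩

open Set MeasureTheory MvPolynomial in
open Literature.NumberTheory.Transcendental in
open Literature.ModelTheory.ExponentialFields in
/-- Auxiliary step `isSemialgebraic_pos4`: is Semialgebraic pos4. [bookkeeping] -/
private theorem isSemialgebraic_pos4 (q : MvPolynomial (Fin 4) ℚ) :
    IsSemialgebraic ℚ {p : Fin 4 → ℝ | 0 < MvPolynomial.aeval p q} :=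
  Literature.ModelTheory.ExponentialFields.isSemialgebraic_setOf_eval_pos (k := ℚ) q

/-- Auxiliary step `L22_eq_toLin'`: L22 eq to Lin'. [bookkeeping] -/
theorem L22_eq_toLin' (p : Fin 4 → ℝ) :
    (L22 p : (Fin 4 → ℝ) →ₗ[ℝ] (Fin 4 → ℝ)) = Matrix.toLin' (M22 p) := by
  apply LinearMap.ext
  intro h
  rw [Matrix.toLin'_apply, ContinuousLinearMap.coe_coe]
  funext i; rw [L22_apply]; fin_cases i
  · simp [row22, M22, Matrix.mulVec, dotProduct, Fin.sum_univ_four]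
  · simp [row22, M22, Matrix.mulVec, dotProduct, Fin.sum_univ_four]
  · simp [row22, M22, Matrix.mulVec, dotProduct, Fin.sum_univ_four, d2_apply]; ring
  · simp [row22, M22, Matrix.mulVec, dotProduct, Fin.sum_univ_four, d2_apply]; ring

/-- Auxiliary step `det_M22`: det M22. [bookkeeping] -/
theorem det_M22 (p : Fin 4 → ℝ) : (M22 p).det = p 1 ^ 2 := by
  rw [Matrix.det_succ_row_zero]; simp [M22, Fin.sum_univ_succ, Matrix.det_fin_three, Fin.succAbove]; ring

/-- Auxiliary step `abs_det_L22`: abs det L22. [bookkeeping] -/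
theorem abs_det_L22 {p : Fin 4 → ℝ} (_hp : p ∈ dom22) : |(L22 p).det| = p 1 ^ 2 := by
  have : (L22 p).det = p 1 ^ 2 := by
    show LinearMap.det (L22 p : (Fin 4 → ℝ) →ₗ[ℝ] (Fin 4 → ℝ)) = _; rw [L22_eq_toLin', LinearMap.det_toLin', det_M22]
  rw [this, abs_of_nonneg (sq_nonneg _)]

/-- **THE PRODUCT CHART `Δ₂ × Δ₂ → Δ₄`, PROVED**: `[Δ₂×Δ₂, (f ∘ Φ₂₂)·a₁²] ≡ [Δ₄, f]`
(BCS product map `M_{0,7} → M_{0,5} × M_{0,5}` in simplicial coordinates). -/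
theorem prod22_rel (r r' : KZ.IntegralRep 4) (hr : r.domain = dom22) (hr' : r'.domain = KZ.openOrderedSimplex 4)
    (h : ∀ p ∈ dom22, r.integrand p = r'.integrand (map22 p) * p 1 ^ 2) :
    KZ.of r - KZ.of r' ∈ KZ.relations := by
  refine chart_rel r r' (by rw [hr]; exact isSemialgebraicMapOn_map22) hasFDerivAt_map22
    (by rw [hr]; exact injOn_map22) (fun p hp => abs_det_L22 (by rw [← hr]; exact hp))
    (by rw [hr, image_map22, hr']) fun p hp => h p (by rw [← hr]; exact hp)

/-! ## 3  `Φ₁₃ : Δ₁ × Δ₃ → Δ₄`, `(a,b₀,b₁,b₂) ↦ (a, ab₀, ab₁, ab₂)` -/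

/-- `Δ₁ × Δ₃` in the coordinates `(a, b₀, b₁, b₂)` -/
def dom13 : Set (Fin 4 → ℝ) := {p | 0 < p 0 ∧ p 0 < 1 ∧ p 2 < p 1 ∧ p 1 < 1 ∧ p 3 < p 2 ∧ 0 < p 3}

/-- Auxiliary step `mem_dom13_iff`: mem dom13 iff. [bookkeeping] -/
theorem mem_dom13_iff (p : Fin 4 → ℝ) :
    p ∈ dom13 ↔ 0 < p 0 ∧ p 0 < 1 ∧ p 2 < p 1 ∧ p 1 < 1 ∧ p 3 < p 2 ∧ 0 < p 3 := Iff.rfl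

/-- Auxiliary step `isSemialgebraic_dom13`: is Semialgebraic dom13. [bookkeeping] -/
theorem isSemialgebraic_dom13 : IsSemialgebraic ℚ dom13 := by
  have e : dom13 =
      ((((({p : Fin 4 → ℝ | 0 < MvPolynomial.aeval p (X 0 : MvPolynomial (Fin 4) ℚ)} ∩
        {p | 0 < MvPolynomial.aeval p (C 1 - X 0 : MvPolynomial (Fin 4) ℚ)}) ∩
        {p | 0 < MvPolynomial.aeval p (X 1 - X 2 : MvPolynomial (Fin 4) ℚ)}) ∩
        {p | 0 < MvPolynomial.aeval p (C 1 - X 1 : MvPolynomial (Fin 4) ℚ)}) ∩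
        {p | 0 < MvPolynomial.aeval p (X 2 - X 3 : MvPolynomial (Fin 4) ℚ)}) ∩
        {p | 0 < MvPolynomial.aeval p (X 3 : MvPolynomial (Fin 4) ℚ)}) := by
    ext p
    simp only [mem_dom13_iff, Set.mem_inter_iff, Set.mem_setOf_eq, map_sub, MvPolynomial.aeval_X, map_one,
      sub_pos]
    tauto
  rw [e]
  exact (((((isSemialgebraic_pos4 _).inter (isSemialgebraic_pos4 _)).inter (isSemialgebraic_pos4 _)).inter
    (isSemialgebraic_pos4 _)).inter (isSemialgebraic_pos4 _)).inter (isSemialgebraic_pos4 _)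

/-- Auxiliary definition `map13`: map13. [bookkeeping] -/
def map13 (p : Fin 4 → ℝ) : Fin 4 → ℝ := ![p 0, p 0 * p 1, p 0 * p 2, p 0 * p 3]

/-- Auxiliary step `map13_zero`: map13 zero. [bookkeeping] -/
theorem map13_zero (p : Fin 4 → ℝ) : map13 p 0 = p 0 := rfl
/-- Auxiliary step `map13_one`: map13 one. [bookkeeping] -/
theorem map13_one (p : Fin 4 → ℝ) : map13 p 1 = p 0 * p 1 := rfl
/-- Auxiliary step `map13_two`: map13 two. [bookkeeping] -/
theorem map13_two (p : Fin 4 → ℝ) : map13 p 2 = p 0 * p 2 := rfl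
/-- Auxiliary step `map13_three`: map13 three. [bookkeeping] -/
theorem map13_three (p : Fin 4 → ℝ) : map13 p 3 = p 0 * p 3 := rfl

/-- Auxiliary definition `inv13`: inv13. [bookkeeping] -/
def inv13 (t : Fin 4 → ℝ) : Fin 4 → ℝ := ![t 0, t 1 / t 0, t 2 / t 0, t 3 / t 0]

/-- Auxiliary step `map13_mem`: map13 mem. [bookkeeping] -/
theorem map13_mem {p : Fin 4 → ℝ} (hp : p ∈ dom13) : map13 p ∈ KZ.openOrderedSimplex 4 := by
  obtain ⟨h0, h01, h21, h1, h32, h3⟩ := hp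
  rw [mem_Δ4, map13_zero, map13_one, map13_two, map13_three]; refine ⟨mul_pos h0 h3, mul_lt_mul_of_pos_left h32 h0, mul_lt_mul_of_pos_left h21 h0, ?_, h01⟩
  calc p 0 * p 1 < p 0 * 1 := mul_lt_mul_of_pos_left h1 h0
    _ = p 0 := mul_one _

/-- Auxiliary step `inv13_mem`: inv13 mem. [bookkeeping] -/
theorem inv13_mem {t : Fin 4 → ℝ} (ht : t ∈ KZ.openOrderedSimplex 4) : inv13 t ∈ dom13 := by
  obtain ⟨h3, h32, h21, h10, h0⟩ := (mem_Δ4 t).1 ht; have h0' : 0 < t 0 := by linarith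
  simp only [mem_dom13_iff, inv13, Matrix.cons_val_zero, Matrix.cons_val_one, Matrix.head_cons,
    Matrix.cons_val_two, Matrix.tail_cons, Matrix.cons_val_three]
  refine ⟨h0', h0, div_lt_div_of_pos_right h21 h0', by rw [div_lt_one h0']; exact h10,
    div_lt_div_of_pos_right h32 h0', div_pos h3 h0'⟩

/-- Auxiliary step `map13_inv13`: map13 inv13. [bookkeeping] -/
theorem map13_inv13 {t : Fin 4 → ℝ} (ht : t ∈ KZ.openOrderedSimplex 4) : map13 (inv13 t) = t := by
  obtain ⟨h3, h32, h21, h10, h0⟩ := (mem_Δ4 t).1 ht; have h0' : t 0 ≠ 0 := by linarith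
  funext i; fin_cases i
  · simp [map13, inv13]
  · simp [map13, inv13]; field_simp
  · simp [map13, inv13]; field_simp
  · simp [map13, inv13]; field_simp

/-- Auxiliary step `inv13_map13`: inv13 map13. [bookkeeping] -/
theorem inv13_map13 {p : Fin 4 → ℝ} (hp : p ∈ dom13) : inv13 (map13 p) = p := by
  have h0 : p 0 ≠ 0 := hp.1.ne'; funext i; fin_cases i
  · simp [map13, inv13]
  · simp [map13, inv13]; field_simp
  · simp [map13, inv13]; field_simp
  · simp [map13, inv13]; field_simp

/-- Auxiliary step `image_map13`: image map13. [bookkeeping] -/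
theorem image_map13 : map13 '' dom13 = KZ.openOrderedSimplex 4 := by
  ext t; constructor
  · rintro ⟨p, hp, rfl⟩; exact map13_mem hp
  · intro ht; exact ⟨inv13 t, inv13_mem ht, map13_inv13 ht⟩

/-- Auxiliary step `injOn_map13`: inj On map13. [bookkeeping] -/
theorem injOn_map13 : InjOn map13 dom13 :=
  fun p hp q hq h => by rw [← inv13_map13 hp, ← inv13_map13 hq, h]

/-- Auxiliary step `isSemialgebraicMapOn_map13`: is Semialgebraic Map On map13. [bookkeeping] -/
theorem isSemialgebraicMapOn_map13 : IsSemialgebraicMapOn ℚ dom13 map13 :=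
  (isSemialgebraicMapOn_aeval isSemialgebraic_dom13
    ![X 0, X 0 * X 1, X 0 * X 2, (X 0 * X 3 : MvPolynomial (Fin 4) ℚ)]).congr
    fun p _ => by
      funext j
      fin_cases j <;> simp [map13_zero, map13_one, map13_two, map13_three]

/-- Auxiliary definition `row13`: row13. [bookkeeping] -/
def row13 (p : Fin 4 → ℝ) : Fin 4 → ((Fin 4 → ℝ) →L[ℝ] ℝ) := ![Pj 0, d2 p 0 1, d2 p 0 2, d2 p 0 3]

/-- Auxiliary definition `L13`: L13. [bookkeeping] -/
def L13 (p : Fin 4 → ℝ) : (Fin 4 → ℝ) →L[ℝ] (Fin 4 → ℝ) := ContinuousLinearMap.pi (row13 p)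

/-- Auxiliary step `L13_apply`: L13 apply. [bookkeeping] -/
theorem L13_apply (p h : Fin 4 → ℝ) (i : Fin 4) : L13 p h i = row13 p i h := rfl

/-- Auxiliary step `hasFDerivAt_map13`: has FDeriv At map13. [bookkeeping] -/
theorem hasFDerivAt_map13 (p : Fin 4 → ℝ) : HasFDerivAt map13 (L13 p) p := by
  have key : HasFDerivAt (fun q : Fin 4 → ℝ => fun i => (![q 0, q 0 * q 1, q 0 * q 2, q 0 * q 3] :
      Fin 4 → ℝ) i) (ContinuousLinearMap.pi (row13 p)) p := by
    refine hasFDerivAt_pi.2 fun i => ?_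
    fin_cases i
    · simpa [row13] using hasFDerivAt_coord 0 p
    · simpa [row13] using hasFDerivAt_d2 p 0 1
    · simpa [row13] using hasFDerivAt_d2 p 0 2
    · simpa [row13] using hasFDerivAt_d2 p 0 3
  exact key

/-- Auxiliary definition `M13`: M13. [bookkeeping] -/
def M13 (p : Fin 4 → ℝ) : Matrix (Fin 4) (Fin 4) ℝ :=
  !![1, 0, 0, 0; p 1, p 0, 0, 0; p 2, 0, p 0, 0; p 3, 0, 0, p 0]

/-- Auxiliary step `L13_eq_toLin'`: L13 eq to Lin'. [bookkeeping] -/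
theorem L13_eq_toLin' (p : Fin 4 → ℝ) :
    (L13 p : (Fin 4 → ℝ) →ₗ[ℝ] (Fin 4 → ℝ)) = Matrix.toLin' (M13 p) := by
  apply LinearMap.ext; intro h; rw [Matrix.toLin'_apply, ContinuousLinearMap.coe_coe]; funext i; rw [L13_apply]; fin_cases i
  · simp [row13, M13, Matrix.mulVec, dotProduct, Fin.sum_univ_four]
  · simp [row13, M13, Matrix.mulVec, dotProduct, Fin.sum_univ_four, d2_apply]; ring
  · simp [row13, M13, Matrix.mulVec, dotProduct, Fin.sum_univ_four, d2_apply]; ring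
  · simp [row13, M13, Matrix.mulVec, dotProduct, Fin.sum_univ_four, d2_apply]; ring

/-- Auxiliary step `det_M13`: det M13. [bookkeeping] -/
theorem det_M13 (p : Fin 4 → ℝ) : (M13 p).det = p 0 ^ 3 := by
  rw [Matrix.det_succ_row_zero]; simp [M13, Fin.sum_univ_succ, Matrix.det_fin_three, Fin.succAbove]; ring

/-- Auxiliary step `abs_det_L13`: abs det L13. [bookkeeping] -/
theorem abs_det_L13 {p : Fin 4 → ℝ} (hp : p ∈ dom13) : |(L13 p).det| = p 0 ^ 3 := by
  have : (L13 p).det = p 0 ^ 3 := by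
    show LinearMap.det (L13 p : (Fin 4 → ℝ) →ₗ[ℝ] (Fin 4 → ℝ)) = _; rw [L13_eq_toLin', LinearMap.det_toLin', det_M13]
  rw [this, abs_of_pos (pow_pos hp.1 3)]

/-- **THE PRODUCT CHART `Δ₁ × Δ₃ → Δ₄`, PROVED**: `[Δ₁×Δ₃, (f ∘ Φ₁₃)·a³] ≡ [Δ₄, f]`
(BCS product map `M_{0,7} → M_{0,4} × M_{0,6}` in simplicial coordinates). -/
theorem prod13_rel (r r' : KZ.IntegralRep 4) (hr : r.domain = dom13) (hr' : r'.domain = KZ.openOrderedSimplex 4)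
    (h : ∀ p ∈ dom13, r.integrand p = r'.integrand (map13 p) * p 0 ^ 3) :
    KZ.of r - KZ.of r' ∈ KZ.relations := by
  refine chart_rel r r' (by rw [hr]; exact isSemialgebraicMapOn_map13) hasFDerivAt_map13
    (by rw [hr]; exact injOn_map13) (fun p hp => abs_det_L13 (by rw [← hr]; exact hp))
    (by rw [hr, image_map13, hr']) fun p hp => h p (by rw [← hr]; exact hp)

/-! ## 4  `Φ₃₁ : Δ₃ × Δ₁ → Δ₄`, `(b₀,b₁,b₂,a) ↦ (b₀, b₁, b₂, b₂a)` -/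

/-- `Δ₃ × Δ₁` in the coordinates `(b₀, b₁, b₂, a)` -/
def dom31 : Set (Fin 4 → ℝ) := {p | p 1 < p 0 ∧ p 0 < 1 ∧ p 2 < p 1 ∧ 0 < p 2 ∧ 0 < p 3 ∧ p 3 < 1}

/-- Auxiliary step `mem_dom31_iff`: mem dom31 iff. [bookkeeping] -/
theorem mem_dom31_iff (p : Fin 4 → ℝ) :
    p ∈ dom31 ↔ p 1 < p 0 ∧ p 0 < 1 ∧ p 2 < p 1 ∧ 0 < p 2 ∧ 0 < p 3 ∧ p 3 < 1 := Iff.rfl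

/-- Auxiliary step `isSemialgebraic_dom31`: is Semialgebraic dom31. [bookkeeping] -/
theorem isSemialgebraic_dom31 : IsSemialgebraic ℚ dom31 := by
  have e : dom31 =
      ((((({p : Fin 4 → ℝ | 0 < MvPolynomial.aeval p (X 0 - X 1 : MvPolynomial (Fin 4) ℚ)} ∩
        {p | 0 < MvPolynomial.aeval p (C 1 - X 0 : MvPolynomial (Fin 4) ℚ)}) ∩
        {p | 0 < MvPolynomial.aeval p (X 1 - X 2 : MvPolynomial (Fin 4) ℚ)}) ∩
        {p | 0 < MvPolynomial.aeval p (X 2 : MvPolynomial (Fin 4) ℚ)}) ∩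
        {p | 0 < MvPolynomial.aeval p (X 3 : MvPolynomial (Fin 4) ℚ)}) ∩
        {p | 0 < MvPolynomial.aeval p (C 1 - X 3 : MvPolynomial (Fin 4) ℚ)}) := by
    ext p
    simp only [mem_dom31_iff, Set.mem_inter_iff, Set.mem_setOf_eq, map_sub, MvPolynomial.aeval_X, map_one,
      sub_pos]
    tauto
  rw [e]
  exact (((((isSemialgebraic_pos4 _).inter (isSemialgebraic_pos4 _)).inter (isSemialgebraic_pos4 _)).inter
    (isSemialgebraic_pos4 _)).inter (isSemialgebraic_pos4 _)).inter (isSemialgebraic_pos4 _)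

/-- Auxiliary definition `map31`: map31. [bookkeeping] -/
def map31 (p : Fin 4 → ℝ) : Fin 4 → ℝ := ![p 0, p 1, p 2, p 2 * p 3]

/-- Auxiliary step `map31_zero`: map31 zero. [bookkeeping] -/
theorem map31_zero (p : Fin 4 → ℝ) : map31 p 0 = p 0 := rfl
/-- Auxiliary step `map31_one`: map31 one. [bookkeeping] -/
theorem map31_one (p : Fin 4 → ℝ) : map31 p 1 = p 1 := rfl
/-- Auxiliary step `map31_two`: map31 two. [bookkeeping] -/
theorem map31_two (p : Fin 4 → ℝ) : map31 p 2 = p 2 := rfl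
/-- Auxiliary step `map31_three`: map31 three. [bookkeeping] -/
theorem map31_three (p : Fin 4 → ℝ) : map31 p 3 = p 2 * p 3 := rfl

/-- Auxiliary definition `inv31`: inv31. [bookkeeping] -/
def inv31 (t : Fin 4 → ℝ) : Fin 4 → ℝ := ![t 0, t 1, t 2, t 3 / t 2]

/-- Auxiliary step `map31_mem`: map31 mem. [bookkeeping] -/
theorem map31_mem {p : Fin 4 → ℝ} (hp : p ∈ dom31) : map31 p ∈ KZ.openOrderedSimplex 4 := by
  obtain ⟨h10, h0, h21, h2, h3, h31⟩ := hp; rw [mem_Δ4, map31_zero, map31_one, map31_two, map31_three]; refine ⟨mul_pos h2 h3, ?_, h21, h10, h0⟩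
  calc p 2 * p 3 < p 2 * 1 := mul_lt_mul_of_pos_left h31 h2
    _ = p 2 := mul_one _

/-- Auxiliary step `inv31_mem`: inv31 mem. [bookkeeping] -/
theorem inv31_mem {t : Fin 4 → ℝ} (ht : t ∈ KZ.openOrderedSimplex 4) : inv31 t ∈ dom31 := by
  obtain ⟨h3, h32, h21, h10, h0⟩ := (mem_Δ4 t).1 ht; have h2 : 0 < t 2 := by linarith
  simp only [mem_dom31_iff, inv31, Matrix.cons_val_zero, Matrix.cons_val_one, Matrix.head_cons,
    Matrix.cons_val_two, Matrix.tail_cons, Matrix.cons_val_three]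
  refine ⟨h10, h0, h21, h2, div_pos h3 h2, by rw [div_lt_one h2]; exact h32⟩

/-- Auxiliary step `map31_inv31`: map31 inv31. [bookkeeping] -/
theorem map31_inv31 {t : Fin 4 → ℝ} (ht : t ∈ KZ.openOrderedSimplex 4) : map31 (inv31 t) = t := by
  obtain ⟨h3, h32, h21, h10, h0⟩ := (mem_Δ4 t).1 ht; have h2 : t 2 ≠ 0 := by linarith
  funext i; fin_cases i
  · simp [map31, inv31]
  · simp [map31, inv31]
  · simp [map31, inv31]
  · simp [map31, inv31]; field_simp

/-- Auxiliary step `inv31_map31`: inv31 map31. [bookkeeping] -/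
theorem inv31_map31 {p : Fin 4 → ℝ} (hp : p ∈ dom31) : inv31 (map31 p) = p := by
  have h2 : p 2 ≠ 0 := hp.2.2.2.1.ne'; funext i; fin_cases i
  · simp [map31, inv31]
  · simp [map31, inv31]
  · simp [map31, inv31]
  · simp [map31, inv31]; field_simp

/-- Auxiliary step `image_map31`: image map31. [bookkeeping] -/
theorem image_map31 : map31 '' dom31 = KZ.openOrderedSimplex 4 := by
  ext t; constructor
  · rintro ⟨p, hp, rfl⟩; exact map31_mem hp
  · intro ht; exact ⟨inv31 t, inv31_mem ht, map31_inv31 ht⟩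

/-- Auxiliary step `injOn_map31`: inj On map31. [bookkeeping] -/
theorem injOn_map31 : InjOn map31 dom31 :=
  fun p hp q hq h => by rw [← inv31_map31 hp, ← inv31_map31 hq, h]

/-- Auxiliary step `isSemialgebraicMapOn_map31`: is Semialgebraic Map On map31. [bookkeeping] -/
theorem isSemialgebraicMapOn_map31 : IsSemialgebraicMapOn ℚ dom31 map31 :=
  (isSemialgebraicMapOn_aeval isSemialgebraic_dom31
    ![X 0, X 1, X 2, (X 2 * X 3 : MvPolynomial (Fin 4) ℚ)]).congr
    fun p _ => by
      funext j
      fin_cases j <;> simp [map31_zero, map31_one, map31_two, map31_three]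

/-- Auxiliary definition `row31`: row31. [bookkeeping] -/
def row31 (p : Fin 4 → ℝ) : Fin 4 → ((Fin 4 → ℝ) →L[ℝ] ℝ) := ![Pj 0, Pj 1, Pj 2, d2 p 2 3]

/-- Auxiliary definition `L31`: L31. [bookkeeping] -/
def L31 (p : Fin 4 → ℝ) : (Fin 4 → ℝ) →L[ℝ] (Fin 4 → ℝ) := ContinuousLinearMap.pi (row31 p)

/-- Auxiliary step `L31_apply`: L31 apply. [bookkeeping] -/
theorem L31_apply (p h : Fin 4 → ℝ) (i : Fin 4) : L31 p h i = row31 p i h := rfl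

/-- Auxiliary step `hasFDerivAt_map31`: has FDeriv At map31. [bookkeeping] -/
theorem hasFDerivAt_map31 (p : Fin 4 → ℝ) : HasFDerivAt map31 (L31 p) p := by
  have key : HasFDerivAt (fun q : Fin 4 → ℝ => fun i => (![q 0, q 1, q 2, q 2 * q 3] :
      Fin 4 → ℝ) i) (ContinuousLinearMap.pi (row31 p)) p := by
    refine hasFDerivAt_pi.2 fun i => ?_
    fin_cases i
    · simpa [row31] using hasFDerivAt_coord 0 p
    · simpa [row31] using hasFDerivAt_coord 1 p
    · simpa [row31] using hasFDerivAt_coord 2 p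
    · simpa [row31] using hasFDerivAt_d2 p 2 3
  exact key

/-- Auxiliary definition `M31`: M31. [bookkeeping] -/
def M31 (p : Fin 4 → ℝ) : Matrix (Fin 4) (Fin 4) ℝ :=
  !![1, 0, 0, 0; 0, 1, 0, 0; 0, 0, 1, 0; 0, 0, p 3, p 2]

/-- Auxiliary step `L31_eq_toLin'`: L31 eq to Lin'. [bookkeeping] -/
theorem L31_eq_toLin' (p : Fin 4 → ℝ) :
    (L31 p : (Fin 4 → ℝ) →ₗ[ℝ] (Fin 4 → ℝ)) = Matrix.toLin' (M31 p) := by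
  apply LinearMap.ext; intro h; rw [Matrix.toLin'_apply, ContinuousLinearMap.coe_coe]; funext i; rw [L31_apply]; fin_cases i
  · simp [row31, M31, Matrix.mulVec, dotProduct, Fin.sum_univ_four]
  · simp [row31, M31, Matrix.mulVec, dotProduct, Fin.sum_univ_four]
  · simp [row31, M31, Matrix.mulVec, dotProduct, Fin.sum_univ_four]
  · simp [row31, M31, Matrix.mulVec, dotProduct, Fin.sum_univ_four, d2_apply]; ring

/-- Auxiliary step `det_M31`: det M31. [bookkeeping] -/
theorem det_M31 (p : Fin 4 → ℝ) : (M31 p).det = p 2 := by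
  rw [Matrix.det_succ_row_zero]; simp [M31, Fin.sum_univ_succ, Matrix.det_fin_three, Fin.succAbove]

/-- Auxiliary step `abs_det_L31`: abs det L31. [bookkeeping] -/
theorem abs_det_L31 {p : Fin 4 → ℝ} (hp : p ∈ dom31) : |(L31 p).det| = p 2 := by
  have : (L31 p).det = p 2 := by
    show LinearMap.det (L31 p : (Fin 4 → ℝ) →ₗ[ℝ] (Fin 4 → ℝ)) = _; rw [L31_eq_toLin', LinearMap.det_toLin', det_M31]
  rw [this, abs_of_pos hp.2.2.2.1]

/-- **THE PRODUCT CHART `Δ₃ × Δ₁ → Δ₄`, PROVED**: `[Δ₃×Δ₁, (f ∘ Φ₃₁)·b₂] ≡ [Δ₄, f]`. -/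
theorem prod31_rel (r r' : KZ.IntegralRep 4) (hr : r.domain = dom31) (hr' : r'.domain = KZ.openOrderedSimplex 4)
    (h : ∀ p ∈ dom31, r.integrand p = r'.integrand (map31 p) * p 2) :
    KZ.of r - KZ.of r' ∈ KZ.relations := by
  refine chart_rel r r' (by rw [hr]; exact isSemialgebraicMapOn_map31) hasFDerivAt_map31
    (by rw [hr]; exact injOn_map31) (fun p hp => abs_det_L31 (by rw [← hr]; exact hp))
    (by rw [hr, image_map31, hr']) fun p hp => h p (by rw [← hr]; exact hp)

/-! ## §5 Integrability transport along the product charts (input of (F₄-long), Facet4_v3 §6):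
`f ∈ L¹(Δ₄)` iff the pulled-back `f ∘ Φ · |Jac|` is in `L¹` of the product cell. -/

/-- Auxiliary step `measurableSet_dom22` (§5): measurable Set dom22. [bookkeeping] -/
theorem measurableSet_dom22 : MeasurableSet dom22 := IsSemialgebraic.measurableSet_holds isSemialgebraic_dom22
/-- Auxiliary step `measurableSet_dom13` (§5): measurable Set dom13. [bookkeeping] -/
theorem measurableSet_dom13 : MeasurableSet dom13 := IsSemialgebraic.measurableSet_holds isSemialgebraic_dom13
/-- Auxiliary step `measurableSet_dom31` (§5): measurable Set dom31. [bookkeeping] -/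
theorem measurableSet_dom31 : MeasurableSet dom31 := IsSemialgebraic.measurableSet_holds isSemialgebraic_dom31

/-- `Φ₂₂`: `f ∈ L¹(Δ₄) ↔ (f ∘ Φ₂₂) · a₁² ∈ L¹(Δ₂ × Δ₂)` -/
theorem integrableOn_pull22_iff (f : (Fin 4 → ℝ) → ℝ) :
    IntegrableOn f (KZ.openOrderedSimplex 4) ↔ IntegrableOn (fun p => f (map22 p) * p 1 ^ 2) dom22 := by
  rw [← image_map22, integrableOn_image_iff_integrableOn_abs_det_fderiv_smul (μ := volume) measurableSet_dom22
    (fun x _ => (hasFDerivAt_map22 x).hasFDerivWithinAt) injOn_map22 f]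
  exact integrableOn_congr_fun (fun p hp => by rw [abs_det_L22 hp, smul_eq_mul, mul_comm]) measurableSet_dom22

/-- `Φ₁₃`: `f ∈ L¹(Δ₄) ↔ (f ∘ Φ₁₃) · a³ ∈ L¹(Δ₁ × Δ₃)` -/
theorem integrableOn_pull13_iff (f : (Fin 4 → ℝ) → ℝ) :
    IntegrableOn f (KZ.openOrderedSimplex 4) ↔ IntegrableOn (fun p => f (map13 p) * p 0 ^ 3) dom13 := by
  rw [← image_map13, integrableOn_image_iff_integrableOn_abs_det_fderiv_smul (μ := volume) measurableSet_dom13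
    (fun x _ => (hasFDerivAt_map13 x).hasFDerivWithinAt) injOn_map13 f]
  exact integrableOn_congr_fun (fun p hp => by rw [abs_det_L13 hp, smul_eq_mul, mul_comm]) measurableSet_dom13

/-- `Φ₃₁`: `f ∈ L¹(Δ₄) ↔ (f ∘ Φ₃₁) · b₂ ∈ L¹(Δ₃ × Δ₁)` -/
theorem integrableOn_pull31_iff (f : (Fin 4 → ℝ) → ℝ) :
    IntegrableOn f (KZ.openOrderedSimplex 4) ↔ IntegrableOn (fun p => f (map31 p) * p 2) dom31 := by
  rw [← image_map31, integrableOn_image_iff_integrableOn_abs_det_fderiv_smul (μ := volume) measurableSet_dom31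
    (fun x _ => (hasFDerivAt_map31 x).hasFDerivWithinAt) injOn_map31 f]
  exact integrableOn_congr_fun (fun p hp => by rw [abs_det_L31 hp, smul_eq_mul, mul_comm]) measurableSet_dom31

/-! ## 6  `Φ_B : Δ₂ × Δ₂ → Δ₄`, `(a₀,a₁,b₀,b₁) ↦ (a₀, a₁ + b₀(a₀−a₁), a₁ + b₁(a₀−a₁), a₁)` — the single-cell
(2,2) product map with common points `{∞, t₃, t₀}` (RUNG4 §19): it pulls `ω_{ζ(2)} ⊗ ω_{ζ(2)}` back to the
FRAME MONOMIAL `F_b = 1/(t₀ (1−t₃)(t₁−t₃)(t₀−t₂))`, the 22nd basis element of the convergent space. -/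

/-- Auxiliary definition `mapB` (§5): map B. [bookkeeping] -/
def mapB (p : Fin 4 → ℝ) : Fin 4 → ℝ := ![p 0, p 1 + p 2 * (p 0 - p 1), p 1 + p 3 * (p 0 - p 1), p 1]

end Summit.KontsevichZagierPeriods.KontsevichZagierPeriods.Cruxes.GZNormalFormWThree.GZLadder.ProdFour
end
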